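import Literature.Computability.Cryptography.HallgrenClassGroupTorsionWitnessBit
import Literature.Computability.Cryptography.HallgrenClassGroupIdealEnumerationProduct
import Literature.Computability.Cryptography.HallgrenClassGroupTorsionSamplerBound
import Literature.Computability.Cryptography.HallgrenClassGroupSingleClassOrder
import Literature.Computability.Cryptography.HallgrenClassGroupDiscriminant
import Literature.NumberTheory.QuadraticFields.ImaginaryResidueClassNumber
import Literature.NumberTheory.QuadraticFields.ClassNumberLeAbs
import HarnessLib

/-!
# The torsion-witness sampler, yes side: many good queries `⟨bin d, ⟨bin a, bin k⟩⟩ ∈ TWBIT`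

For a negative fundamental discriminant `−d` with `3 ∣ h(−d)` and a bright residue
(`c / log d ≤ Res ζ_K`), the number of pairs `(a, k)`, `1 ≤ a ≤ Y`, `k < R`, whose torsion-witness query
is a YES instance of `TWBIT` is at least the number of "uncrowded" ideals of norm `≤ Y` whose class has
order divisible by `3` (`le_card_filter_mem_twbLang`, `ncard_le_sum_card_filter`: the dictionary
`FormComposition.ncard_absNorm_eq_eq_card_filter` between the ideals of norm `a` and the indices
`k < enumCount`, and `clGenOrder d [q] = ord [q]`, `clGenOrder_singleton_eq_orderOf_classOf`), hence at
least `2cY / (3π log d)` for `Y ≥ d³`, `R ≥ 3π(1 + log Y)³ log d / c` and `d` large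
(`le_card_ideals_three_dvd_orderOf_uncrowded_of_bright`) — **`le_sum_card_filter_mem_twbLang`**, the
field `K = ℚ(√−d)` being supplied by `IsNegFundamentalDiscr.exists_numberField`. This is the
counting heart of the `BQP` algorithm for `3 ∣ h(−d)` by random norm-`a` ideals (Hallgren 2005, §4;
Cohen 1993, §5.4).

## References

* S. Hallgren, *Fast quantum algorithms for computing the unit group and class group of a number
  field*, STOC 2005, §4 [Hallgren2005].
* H. Cohen, *A Course in Computational Algebraic Number Theory*, GTM 138, Springer 1993, §5.2, §5.4
  [Cohen1993].
* D. A. Cox, *Primes of the form x² + ny²*, 2nd ed., Wiley 2013, §7.B [Cox2013].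
-/

open scoped nonZeroDivisors
open Module NumberField Finset

namespace Literature.Computability.Cryptography.Hallgren2005

namespace TorsionWitness

open FormComposition _root_.Computability Literature.Computability.Complexity
open Literature.NumberTheory.QuadraticFields.Quadratic Literature.NumberTheory.QuadraticFields.Quadratic.BinQF
open Literature.NumberTheory.EllipticCurves

/-! ### No side: a YES query forces `3 ∣ h(−d)` -/

/-- **Soundness of the queries**: if `⟨bin d, ⟨bin a, bin k⟩⟩ ∈ TWBIT` for a negative fundamental
`−d`, then `3 ∣ h(−d)` — the query is a valid one-form instance with answer divisible by `3`
(`three_dvd_classNumber_of_three_dvd_clGenOrder`). [cite: Cox2013, §7.B Thm. 7.7] -/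
theorem three_dvd_classNumber_of_mem_twbLang {d : ℕ} (hd : IsNegFundamentalDiscr d) {a k : ℕ}
    (h : boolPair (encodeNat d) (boolPair (encodeNat a) (encodeNat k)) ∈ twbLang) :
    3 ∣ Literature.NumberTheory.QuadraticFields.BinaryQuadraticForm.classNumber (-(d : ℤ)) := by
  rw [mem_twbLang_iff, twQuery] at h
  split_ifs at h with hk
  · obtain ⟨d', q', he, hinst, h3⟩ := h
    obtain ⟨rfl, hq⟩ := encodeClInstance_inj he
    obtain rfl : q' = toTriple (enumFormR (-(d : ℤ)) (withRoots (-(d : ℤ)) (factorPairs a)) k) :=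
      List.singleton_inj.1 hq.symm
    exact three_dvd_classNumber_of_three_dvd_clGenOrder hd (hinst.2.2 _ (List.mem_singleton_self _)) h3
  · obtain ⟨d', q', he, -, -⟩ := h
    have := congrArg List.length he
    rw [encodeClInstance, length_boolPair, List.length_nil] at this
    omega

/-! ### Yes side: the dictionary with the ideals of norm `a` -/

section Ring

variable {K : Type} [Field K] [NumberField K] (b : Basis (Fin 2) ℤ (𝓞 K)) (hb : b 0 = 1)
  (hω : b 1 * b 1 = (mOf (NumberField.discr K) : 𝓞 K) + (NumberField.discr K : 𝓞 K) * b 1)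

include b hb hω in
/-- **Membership of a query in `TWBIT`, for `k < enumCount`**: `⟨bin d, ⟨bin a, bin k⟩⟩ ∈ TWBIT` iff `3`
divides the order of the class of the `k`-th form above `a`. [cite: Cox2013, §7.B Thm. 7.7] -/
theorem mem_twbLang_iff_three_dvd_orderOf (hK : IsImaginaryQuadratic K) {d : ℕ}
    (hKd : NumberField.discr K = -(d : ℤ)) (hd : 0 < d) {a k : ℕ}
    (hk : k < enumCount (NumberField.discr K) (factorPairs a)) :
    boolPair (encodeNat d) (boolPair (encodeNat a) (encodeNat k)) ∈ twbLang ↔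
      3 ∣ orderOf (classOf b hb (enumForm (NumberField.discr K) (factorPairs a) k)) := by
  have hF : ∀ pe ∈ factorPairs a, pe.1.Prime := fun pe h => prime_of_mem_factorPairs h
  obtain ⟨hf, hr, -⟩ := mk0_idealOf b hb hω hK hF k
  set f := enumForm (NumberField.discr K) (factorPairs a) k with hf_def
  have hf' : f.IsPosPrim (-(d : ℤ)) := hKd ▸ hf
  have hq : (toForm (toTriple f)).IsPosPrim (-(d : ℤ)) ∧ (toForm (toTriple f)).IsReduced := by
    rw [toForm_toTriple hf hr]; exact ⟨hf', hr⟩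
  have hord : clGenOrder d [toTriple f] = orderOf (classOf b hb f) := by
    rw [clGenOrder_singleton_eq_orderOf_classOf hK b hb hω hKd hq, toForm_toTriple hf hr]
  rw [mem_twbLang_iff, ← hKd, twQuery_withRoots b hb hω hK hKd a k, if_pos hk]
  constructor
  · rintro ⟨d', q', he, -, h3⟩
    obtain ⟨rfl, hq'⟩ := encodeClInstance_inj he
    obtain rfl : q' = toTriple f := List.singleton_inj.1 hq'.symm
    rwa [hord] at h3
  · intro h3
    exact ⟨d, toTriple f, rfl, isClInstance_toTriple hd hf' hr, hord ▸ h3⟩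

open Classical in
include b hb hω in
/-- **Good indices at norm `a`**: the uncrowded ideals of norm `a` with class of order divisible by
`3` are at most the indices `k < R` with `⟨bin d, ⟨bin a, bin k⟩⟩ ∈ TWBIT`. [cite: Cohen1993, §5.2] -/
theorem le_card_filter_mem_twbLang (hK : IsImaginaryQuadratic K) {d : ℕ}
    (hKd : NumberField.discr K = -(d : ℤ)) (hd : 0 < d) {a : ℕ} (ha : a ≠ 0) (R : ℕ) :
    Set.ncard {I : Ideal (𝓞 K) | Ideal.absNorm I = a ∧
        (Nat.card {J : Ideal (𝓞 K) // Ideal.absNorm J = Ideal.absNorm I} ≤ R ∧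
          ∃ hI : I ∈ (Ideal (𝓞 K))⁰, 3 ∣ orderOf (ClassGroup.mk0 ⟨I, hI⟩))} ≤
      ((Finset.range R).filter fun k =>
        boolPair (encodeNat d) (boolPair (encodeNat a) (encodeNat k)) ∈ twbLang).card := by
  by_cases hR : Nat.card {J : Ideal (𝓞 K) // Ideal.absNorm J = a} ≤ R
  · have hset : {I : Ideal (𝓞 K) | Ideal.absNorm I = a ∧
        (Nat.card {J : Ideal (𝓞 K) // Ideal.absNorm J = Ideal.absNorm I} ≤ R ∧
          ∃ hI : I ∈ (Ideal (𝓞 K))⁰, 3 ∣ orderOf (ClassGroup.mk0 ⟨I, hI⟩))} =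
        {I : Ideal (𝓞 K) | Ideal.absNorm I = a ∧
          ∃ hI : I ∈ (Ideal (𝓞 K))⁰, (fun C => 3 ∣ orderOf C) (ClassGroup.mk0 ⟨I, hI⟩)} := by
      ext I
      simp only [Set.mem_setOf_eq]
      exact ⟨fun ⟨h1, _, h3⟩ => ⟨h1, h3⟩, fun ⟨h1, h3⟩ => ⟨h1, h1.symm ▸ hR, h3⟩⟩
    rw [hset, ncard_absNorm_eq_eq_card_filter b hb hω hK (fun C => 3 ∣ orderOf C) ha]
    rw [card_absNorm_eq b hb hω hK ha] at hR
    refine Finset.card_le_card fun k hk => ?_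
    simp only [Finset.mem_filter, Finset.mem_range] at hk ⊢
    exact ⟨lt_of_lt_of_le hk.1 hR, (mem_twbLang_iff_three_dvd_orderOf b hb hω hK hKd hd hk.1).2 hk.2⟩
  · rw [show {I : Ideal (𝓞 K) | Ideal.absNorm I = a ∧
        (Nat.card {J : Ideal (𝓞 K) // Ideal.absNorm J = Ideal.absNorm I} ≤ R ∧
          ∃ hI : I ∈ (Ideal (𝓞 K))⁰, 3 ∣ orderOf (ClassGroup.mk0 ⟨I, hI⟩))} = ∅ from ?_]
    · simp
    · ext I
      simp only [Set.mem_setOf_eq, Set.mem_empty_iff_false, iff_false, not_and]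
      intro hI hle
      rw [hI] at hle
      exact absurd hle hR

open Classical in
include b hb hω in
/-- **Summing over the norms**: the uncrowded ideals of norm `≤ Y` with class of order divisible by
`3` are at most `Σ_{1 ≤ a ≤ Y} #{k < R : ⟨bin d, ⟨bin a, bin k⟩⟩ ∈ TWBIT}`. [cite: Cohen1993, §5.2] -/
theorem ncard_le_sum_card_filter (hK : IsImaginaryQuadratic K) {d : ℕ}
    (hKd : NumberField.discr K = -(d : ℤ)) (hd : 0 < d) (Y R : ℕ) :
    (Set.ncard {I : Ideal (𝓞 K) | I ≠ ⊥ ∧ Ideal.absNorm I ≤ Y ∧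
        Nat.card {J : Ideal (𝓞 K) // Ideal.absNorm J = Ideal.absNorm I} ≤ R ∧
        ∃ hI : I ∈ (Ideal (𝓞 K))⁰, 3 ∣ orderOf (ClassGroup.mk0 ⟨I, hI⟩)} : ℝ) ≤
      ∑ a ∈ Icc 1 Y, (((Finset.range R).filter fun k =>
        boolPair (encodeNat d) (boolPair (encodeNat a) (encodeNat k)) ∈ twbLang).card : ℝ) := by
  rw [ncard_ideals_norm_le_eq_sum (fun I => Nat.card {J : Ideal (𝓞 K) // Ideal.absNorm J = Ideal.absNorm I} ≤ R ∧
    ∃ hI : I ∈ (Ideal (𝓞 K))⁰, 3 ∣ orderOf (ClassGroup.mk0 ⟨I, hI⟩)) Y]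
  push_cast
  refine Finset.sum_le_sum fun a ha => ?_
  have ha0 : a ≠ 0 := by rw [Finset.mem_Icc] at ha; omega
  exact_mod_cast le_card_filter_mem_twbLang b hb hω hK hKd hd ha0 R

end Ring

/-! ### Yes side: the count for a bright discriminant -/

open Classical in
/-- **Many good queries for a bright discriminant.** For `−d` negative fundamental with `3 ∣ h(−d)`,
`c / log d ≤ Res ζ_K` for the quadratic fields of discriminant `−d`, `d` large
(`6π log d / c ≤ √d`, `4 < d`), `Y ≥ d³` and `R ≥ 3π(1 + log Y)³ log d / c`:
`2cY / (3π log d) ≤ Σ_{1 ≤ a ≤ Y} #{k < R : ⟨bin d, ⟨bin a, bin k⟩⟩ ∈ TWBIT}`. [cite: Hallgren2005, §4] -/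
theorem le_sum_card_filter_mem_twbLang {d : ℕ} (hd : IsNegFundamentalDiscr d)
    (h3 : 3 ∣ Literature.NumberTheory.QuadraticFields.BinaryQuadraticForm.classNumber (-(d : ℤ)))
    {c : ℝ} (hc : 0 < c)
    (hbright : ∀ (K : Type) [Field K] [NumberField K], Module.finrank ℚ K = 2 →
      NumberField.discr K = -(d : ℤ) → c / Real.log d ≤ NumberField.dedekindZeta_residue K)
    (hd4 : 4 < d) (hlarge : 6 * Real.pi * Real.log d / c ≤ Real.sqrt d) {Y R : ℕ}
    (hY : (d : ℝ) ^ 3 ≤ Y) (hR : 0 < R) (hRge : 3 * Real.pi * (1 + Real.log Y) ^ 3 * Real.log d / c ≤ R) :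
    2 * c * Y / (3 * Real.pi * Real.log d) ≤
      ∑ a ∈ Icc 1 Y, (((Finset.range R).filter fun k =>
        boolPair (encodeNat d) (boolPair (encodeNat a) (encodeNat k)) ∈ twbLang).card : ℝ) := by
  obtain ⟨K, _, _, h2, hK⟩ := hd.exists_numberField
  have hIQ : IsImaginaryQuadratic K := isImaginaryQuadratic_iff_discr_neg.2 ⟨h2, hK ▸ hd.neg_lt_zero⟩
  obtain ⟨b, hb, hω⟩ := exists_basis_canonical h2
  have hcard : Literature.NumberTheory.QuadraticFields.BinaryQuadraticForm.classNumber (-(d : ℤ)) =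
      Fintype.card (ClassGroup (𝓞 K)) := hd.classNumber_eq_card_classGroup h2 hK
  have h3' : 3 ∣ Fintype.card (ClassGroup (𝓞 K)) := hcard ▸ h3
  have hbr : c * Real.sqrt d / (Real.pi * Real.log d) ≤ Fintype.card (ClassGroup (𝓞 K)) := by
    have h := Literature.NumberTheory.QuadraticFields.Quadratic.le_classNumber_of_dedekindZeta_residue_ge
      h2 hK (hbright K h2 hK)
    exact h
  have hhd : (Fintype.card (ClassGroup (𝓞 K)) : ℝ) ≤ d := by
    rw [← hcard]
    exact_mod_cast (Literature.NumberTheory.QuadraticFields.BinaryQuadraticForm.classNumber_le_natAbs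
      hd.neg_lt_zero).trans (by simp)
  have hlog : 0 < Real.log d := Real.log_pos (by exact_mod_cast (show 1 < d by omega))
  have hd4' : NumberField.discr K < -4 := by rw [hK]; omega
  exact (le_card_ideals_three_dvd_orderOf_uncrowded_of_bright hIQ hd4' h3' hc hK hbr hhd hlog hlarge hY hR
    hRge).trans (ncard_le_sum_card_filter b hb hω hIQ hK (by omega) Y R)

end TorsionWitness

end Literature.Computability.Cryptography.Hallgren2005
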